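import Literature.AnabelianGeometry.AbsoluteAnabelian.LocalResidueMapRestriction
import Literature.AnabelianGeometry.AbsoluteAnabelian.AbsTopIII.ReconstructionCor110iiPrime
import HarnessLib

/-!
# The Kummer map with `Ẑ(1)`-coefficients under restriction to a finite extension:
# `H¹(res; Ẑ(1)(ι)) ∘ κ̂_F = κ̂_E ∘ (Fˣ ⊆ Eˣ)`

abc-iut cell, layer L4, row «COR110ib-OPEN» (abc-iut-L4-t11; L4-lead RULING #6g): the
OPEN-INJECTIVE half of the functoriality sentence of S. Mochizuki, *Topics in Absolute Anabelian
Geometry III*, Cor. 1.10 (i)(b) p. 42 («the asserted "functoriality" is with respect to arbitrary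
injective open homomorphisms of profinite groups») reduces, after the isomorphism case (reading (N),
abc-iut-L4-d3), to the FIELD-THEORETIC restriction along a finite extension `E/F` of MLFs.  This
proof-only file supplies the Kummer leg of that restriction square at the level of the REAL Tate module
`Ẑ(1)(K̄) = lim_n μ_n(K̄)` (`tateModuleMu`, abc-iut-L4-t11) and of abc-iut-L4-d1's Kummer map with
`Ẑ(1)`-coefficients `κ̂ = kummerTate` (`ReconstructionCor110iiPrime.lean`):

* `Prop121vii.muRes_muPowMap` — the chosen embedding `ι : F̄ → Ē` (abc-iut-w5-d201's
  `Prop121vii.muRes`) commutes with the power maps `μ_m ↠ μ_n`;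
* `resMu_kummerMap` — **finite level**: `Res (δ_n(a)) = δ_n(a)` in `H¹(Γ_E, μ_n(Ē))` for `a ∈ Fˣ`
  read in `Eˣ`, `Res = Prop121vii.resMu F E n 1` the restriction along
  `(res : Γ_E → Γ_F, ι|μ_n)` (Serre, *Galois Cohomology* I §2.4: the Kummer cocycle `σ ↦ σ(α)/α`
  pulls back to the Kummer cocycle of `ι α`, an `n`-th root of `a` in `Ē`);
* `exists_tateResCoeff` — there IS a morphism of topological `Γ_E`-representations
  `Ẑ(1)(F̄)|_{Γ_E} ⟶ Ẑ(1)(Ē)` over `res` which is `ι` in every coordinate (constructed in the proof;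
  no definition is introduced — statements below quantify over any such coefficient morphism `f`);
* `cohomologyMap_projHom_map_tate` — for any such `f`, `H¹(res; f)` is `Res` in every coordinate of
  NSW II §7 Thm. 2.7.5 (`proj_n ∘ H¹(res; f) = Res_n ∘ proj_n`);
* `map_kummerTate` — **the square**: `H¹(res; f) (κ̂_F a) = κ̂_E (a)` for every `a ∈ Fˣ`
  (uniqueness of a class with prescribed coordinates, abc-iut-L4-d1 `eq_kummerTate_of_proj`).

Theorems only (no definition, no named fact, no `sorry`); classical Kummer theory.  HONEST FRAMING:
[AbsTopIII] is a refereed paper; nothing here bears on [IUTchIII] Cor. 3.12 or takes a side.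
-/

noncomputable section

open CategoryTheory Function
open Field

universe u

namespace Literature.AnabelianGeometry.AbsoluteAnabelian

open _root_.TopRep _root_.ContRepresentation _root_.ContinuousCohomology
open Literature.NumberTheory.GaloisRepresentations
open Literature.NumberTheory.GaloisRepresentations.DiscreteGaloisModule

/-! ### `ι` commutes with the transition maps of `(μ_n)_n` -/

namespace Prop121vii

variable (F E : Type u) [Field F] [Field E] [Algebra F E]

/-- The coefficient maps `ι|μ : μ_m(F̄) → μ_m(Ē)` commute with the power maps `μ_m ↠ μ_n`, `ζ ↦ ζ^{m/n}`
(`ι` is multiplicative). [cite: SerreGaloisCohomology1997, I §2.4] -/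
theorem muRes_muPowMap {n m : ℕ} (h : n ∣ m) (v : MuCarrier F m) :
    muRes F E n (muPowMap F h v) = muPowMap E h (muRes F E m v) := by
  apply muVal_injective E n
  rw [muVal_muRes, muVal_muPowMap, muVal_muPowMap, muVal_muRes, map_pow]

end Prop121vii

/-! ### Finite level: the Kummer classes restrict to Kummer classes -/

section Finite

variable (F E : Type u) [Field F] [Field E] [Algebra F E]

/-- `ι : F̄ → Ē` over `F ⊆ E`: `ι (a) = a` for `a ∈ F` read in `Ē` through `E`.
[cite: SerreGaloisCohomology1997, I §2.4] -/
theorem absClosureEmbedding_algebraMap' (a : F) :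
    absClosureEmbedding F E (algebraMap F (AlgebraicClosure F) a) =
      algebraMap E (AlgebraicClosure E) (algebraMap F E a) := by
  rw [AlgHom.commutes, IsScalarTower.algebraMap_apply F E (AlgebraicClosure E)]

/-- On units: `ι (a) = a` for `a ∈ Fˣ` read in `Ēˣ` through `Eˣ`. [cite: SerreGaloisCohomology1997, I §2.4] -/
theorem unitsMap_absClosureEmbedding_algebraMap (a : Fˣ) :
    Units.map (absClosureEmbedding F E).toRingHom.toMonoidHom
        (Units.map (algebraMap F (AlgebraicClosure F) : F →* AlgebraicClosure F) a) =
      Units.map (algebraMap E (AlgebraicClosure E) : E →* AlgebraicClosure E)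
        (Units.map (algebraMap F E : F →* E) a) := by
  ext
  simp only [Units.coe_map, MonoidHom.coe_coe, RingHom.toMonoidHom_eq_coe, AlgHom.toRingHom_eq_coe,
    RingHom.coe_coe]
  exact absClosureEmbedding_algebraMap' F E a

variable (n : ℕ)

/-- `ι` carries Kummer units of level `n` for `F` to Kummer units of level `n` for `E`
(`(ι α)ⁿ = ι(αⁿ)` is fixed by `Γ_E`, being fixed by `res(Γ_E) ⊆ Γ_F`).
[cite: SerreGaloisCohomology1997, II §1.2] -/
theorem unitsMap_absClosureEmbedding_mem_kummerUnits (α : kummerUnits F n) :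
    Units.map (absClosureEmbedding F E).toRingHom.toMonoidHom (α : (AlgebraicClosure F)ˣ) ∈
      kummerUnits E n := by
  intro σ
  rw [← map_pow]
  ext
  change σ • absClosureEmbedding F E (((α : (AlgebraicClosure F)ˣ) ^ n : (AlgebraicClosure F)ˣ) :
      AlgebraicClosure F) =
    absClosureEmbedding F E (((α : (AlgebraicClosure F)ˣ) ^ n : (AlgebraicClosure F)ˣ) : AlgebraicClosure F)
  rw [← absGaloisRestrict_apply_smul, ← Units.coe_smul, α.2 (absGaloisRestrict F E σ)]

/-- The Kummer cocycle of `α` pulls back, along `(res : Γ_E → Γ_F, ι|μ_n)`, to the Kummer cocycle of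
`ι α`: `ι (res σ • α / α) = (σ • ι α) / ι α`. [cite: SerreGaloisCohomology1997, I §2.4] -/
theorem pullback_resCoeff_kummerOneCocycle (α : kummerUnits F n) :
    contOneCocycles.pullback (absGaloisRestrict F E) (Prop121vii.resCoeff F E n)
        (kummerOneCocycle F n α) =
      kummerOneCocycle E n ⟨_, unitsMap_absClosureEmbedding_mem_kummerUnits F E n α⟩ := by
  refine Subtype.ext (ContinuousMap.ext fun σ => muVal_injective E n (Units.ext ?_))
  rw [contOneCocycles.pullback_apply, Prop121vii.resCoeff_hom_apply, Prop121vii.coe_muVal_muRes,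
    kummerOneCocycle_apply, kummerOneCocycle_apply, muVal_kummerOneCocycleFun,
    muVal_kummerOneCocycleFun, Units.val_div_eq_div_val, Units.val_div_eq_div_val, map_div₀,
    Units.coe_smul, Units.coe_smul, Units.coe_map, absGaloisRestrict_apply_smul]
  rfl

variable [NeZero (n : F)] [NeZero (n : E)]

/-- **Kummer naturality under restriction, finite level**: for `a ∈ Fˣ`,
`Res (δ_n(a)) = δ_n(a)` in `H¹(Γ_E, μ_n(Ē))`, where on the right `a` is read in `Eˣ` and
`Res = resMu F E n 1` is the restriction along `(res : Γ_E → Γ_F, ι|μ_n)` — the Kummer cocycle of an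
`n`-th root `α` of `a` pulls back to the Kummer cocycle of `ι α`, an `n`-th root of `a` in `Ē`, and the
Kummer class does not depend on the chosen root. [cite: SerreGaloisCohomology1997, II §1.2] -/
theorem map_resCoeff_kummerMap (a : Fˣ) :
    ContinuousCohomology.map (absGaloisRestrict F E) (Prop121vii.resCoeff F E n) 1
        (Multiplicative.toAdd (kummerMap F n a)) =
      Multiplicative.toAdd (kummerMap E n (Units.map (algebraMap F E : F →* E) a)) := by
  set β : kummerUnits E n := ⟨_, unitsMap_absClosureEmbedding_mem_kummerUnits F E n
    (kummerUnitsRoot F n a)⟩ with hβ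
  have hpow : ((β : kummerUnits E n) : (AlgebraicClosure E)ˣ) ^ n =
      ((kummerUnitsRoot E n (Units.map (algebraMap F E : F →* E) a) : kummerUnits E n) :
        (AlgebraicClosure E)ˣ) ^ n := by
    rw [kummerUnitsRoot_pow, hβ]
    change Units.map (absClosureEmbedding F E).toRingHom.toMonoidHom
        ((kummerUnitsRoot F n a : kummerUnits F n) : (AlgebraicClosure F)ˣ) ^ n = _
    rw [← map_pow, kummerUnitsRoot_pow, unitsMap_absClosureEmbedding_algebraMap]
  have hcl := kummerClassHom_eq_of_pow_eq E n hpow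
  rw [kummerMap_apply, kummerMap_apply, ← hcl, kummerClassHom_apply, kummerClassHom_apply, toAdd_ofAdd,
    toAdd_ofAdd, map_oneCocycleClass, hβ, ← pullback_resCoeff_kummerOneCocycle]

/-- The same in abc-iut-w5-d201's notation `Res = Prop121vii.resMu F E n 1` (which IS
`ContinuousCohomology.map (absGaloisRestrict F E) (resCoeff F E n) 1`, `Prop121vii.resMu_apply`):
`Res (δ_n(a)) = δ_n(a)`. [cite: SerreGaloisCohomology1997, II §1.2] -/
theorem resMu_kummerMap (a : Fˣ) :
    Prop121vii.resMu F E n 1 (Multiplicative.toAdd (kummerMap F n a)) =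
      Multiplicative.toAdd (kummerMap E n (Units.map (algebraMap F E : F →* E) a)) :=
  map_resCoeff_kummerMap F E n a

end Finite

/-! ### The `Ẑ(1)`-coefficient morphism over `res` and the square for `κ̂` -/

section Tate

variable (F E : Type u) [Field F] [Field E] [Algebra F E]

/-- **There is a morphism of topological `Γ_E`-representations `Ẑ(1)(F̄)|_{Γ_E} ⟶ Ẑ(1)(Ē)` over
`res : Γ_E → Γ_F` which is `ι` in every coordinate** (componentwise `Prop121vii.muRes`, compatible
with the power maps by `muRes_muPowMap`, continuous coordinatewise, equivariant by `muRes_smul`).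
Constructed here once; the statements below hold for ANY such morphism.
[cite: NeukirchSchmidtWingberg2008, II §7 Thm 2.7.5] -/
theorem exists_tateResCoeff :
    ∃ f : TopRep.res (absGaloisRestrict F E : absoluteGaloisGroup E →* absoluteGaloisGroup F)
        (tateModuleMu F).toTopRep ⟶ (tateModuleMu E).toTopRep,
      ∀ (x : (muSystem F).limit) (n : ℕ+),
        ((f.hom x : (muSystem E).limit) : ∀ n : ℕ+, MuCarrier E n) n =
          Prop121vii.muRes F E n ((x : ∀ n : ℕ+, MuCarrier F n) n) := by
  let g : (muSystem F).limit →+ (muSystem E).limit :=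
    { toFun := fun x => ⟨fun n => Prop121vii.muRes F E n ((x : ∀ n : ℕ+, MuCarrier F n) n),
        fun n m h => by
          change muPowMap E h (Prop121vii.muRes F E m ((x : ∀ n : ℕ+, MuCarrier F n) m)) = _
          rw [← Prop121vii.muRes_muPowMap, ← muSystem_red F h, (muSystem F).red_apply_coe x h]⟩
      map_zero' := Subtype.ext (funext fun n => by simp)
      map_add' := fun x y => Subtype.ext (funext fun n => by simp) }
  have hg : ∀ (x : (muSystem F).limit) (n : ℕ+),
      ((g x : (muSystem E).limit) : ∀ n : ℕ+, MuCarrier E n) n =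
        Prop121vii.muRes F E n ((x : ∀ n : ℕ+, MuCarrier F n) n) := fun _ _ => rfl
  have hcont : Continuous g := by
    refine continuous_induced_rng.2 (continuous_pi fun n => ?_)
    exact (continuous_of_discreteTopology (f := Prop121vii.muRes F E (n : ℕ))).comp
      ((_root_.continuous_apply n).comp continuous_subtype_val)
  refine ⟨TopRep.ofHom ⟨⟨g.toIntLinearMap, hcont⟩, fun σ => ?_⟩, fun x n => rfl⟩
  refine ContinuousLinearMap.ext fun x => Subtype.ext (funext fun n => ?_)
  change ((g ((tateModuleMu F) (absGaloisRestrict F E σ) x) : (muSystem E).limit) :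
      ∀ n : ℕ+, MuCarrier E n) n =
    (((tateModuleMu E) σ (g x) : (muSystem E).limit) : ∀ n : ℕ+, MuCarrier E n) n
  rw [hg, DiscreteInvSystem.coe_limitRep_apply, DiscreteInvSystem.coe_limitRep_apply, hg]
  exact Prop121vii.muRes_smul F E n σ _

variable {F E}
variable (f : TopRep.res (absGaloisRestrict F E : absoluteGaloisGroup E →* absoluteGaloisGroup F)
    (tateModuleMu F).toTopRep ⟶ (tateModuleMu E).toTopRep)
  (hf : ∀ (x : (muSystem F).limit) (n : ℕ+),
    ((f.hom x : (muSystem E).limit) : ∀ n : ℕ+, MuCarrier E n) n =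
      Prop121vii.muRes F E n ((x : ∀ n : ℕ+, MuCarrier F n) n))
include hf

/-- **`H¹(res; Ẑ(1)(ι))` is `Res` in every coordinate**: for a coefficient morphism `f` over `res` that is
`ι` coordinatewise, `proj_n (H¹(res; f) x) = Res_n (proj_n x)` in `H¹(Γ_E, μ_n(Ē))`, `proj_n` the
coordinates of NSW II §7 Thm. 2.7.5 (`DiscreteInvSystem.projHom`), `Res_n` the restriction along
`(res, ι|μ_n)` (= abc-iut-w5-d201's `Prop121vii.resMu F E n 1`, `resMu_apply`) — both sides are the class
of `σ ↦ ι ((c (res σ))_n)` on a representing cocycle `c`.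
[cite: NeukirchSchmidtWingberg2008, II §7 Thm 2.7.5] -/
theorem cohomologyMap_projHom_map_tate (x : continuousCohomology 1 (tateModuleMu F).toTopRep) (n : ℕ+) :
    cohomologyMap ((muSystem E).projHom n) 1 (ContinuousCohomology.map (absGaloisRestrict F E) f 1 x) =
      ContinuousCohomology.map (absGaloisRestrict F E) (Prop121vii.resCoeff F E n) 1
        (cohomologyMap ((muSystem F).projHom n) 1 x) := by
  obtain ⟨c, rfl⟩ := oneCocycleClass_surjective _ x
  rw [map_oneCocycleClass, cohomologyMap_oneCocycleClass, cohomologyMap_oneCocycleClass,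
    map_oneCocycleClass]
  congr 1
  refine Subtype.ext (ContinuousMap.ext fun σ => ?_)
  rw [contOneCocycles.pullback_apply, contOneCocycles.pullback_apply, contOneCocycles.pullback_apply,
    contOneCocycles.pullback_apply, resIdHom_hom_apply, resIdHom_hom_apply,
    DiscreteInvSystem.projHom_hom_apply, DiscreteInvSystem.projHom_hom_apply, Prop121vii.resCoeff_hom_apply]
  exact hf _ _

variable [CharZero F] [CharZero E]

/-- **The Kummer map with `Ẑ(1)`-coefficients under restriction** (square S1 of «COR110ib-OPEN»):
for every `a ∈ Fˣ`, `H¹(res; Ẑ(1)(ι)) (κ̂_F a) = κ̂_E (a)`, `a` read in `Eˣ` — the class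
`H¹(res; f)(κ̂_F a)` has `n`-th coordinate `Res_n (δ_n(a)) = δ_n(a)` (`resMu_kummerMap`), and `κ̂_E (a)` is
the unique class with these coordinates (abc-iut-L4-d1 `eq_kummerTate_of_proj`).  Cor. 1.10 (i)(b)
p. 42 functoriality for the injective open homomorphism `res : Γ_E ↪ Γ_F`, Kummer leg.
[cite: MochizukiAbsTopIII2015, Cor 1.10 (i) p.42] -/
theorem map_kummerTate (a : Fˣ) :
    ContinuousCohomology.map (absGaloisRestrict F E) f 1 (Multiplicative.toAdd (kummerTate F a)) =
      Multiplicative.toAdd (kummerTate E (Units.map (algebraMap F E : F →* E) a)) := by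
  refine eq_kummerTate_of_proj E _ _ fun n => ?_
  rw [cohomologyMap_projHom_map_tate f hf, cohomologyMap_projHom_kummerTate]
  exact map_resCoeff_kummerMap F E n a

end Tate

end Literature.AnabelianGeometry.AbsoluteAnabelian
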